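import Summits.AnomalousDissipation.AnomalousDissipation.Theses.EnsembleRigidity
import Summits.AnomalousDissipation.AnomalousDissipation.Theorems.GPStatisticalRigidity.Negative.LoadBearing
import Summits.AnomalousDissipation.AnomalousDissipation.Theorems.GPStatisticalRigidity.Negative.DiracShadow
import Summits.AnomalousDissipation.AnomalousDissipation.Theorems.GPStatisticalRigidity.Negative.IntegrableRedundant
import Summits.AnomalousDissipation.AnomalousDissipation.Theorems.GPStatisticalRigidity.Negative.EulerSSS

/-!
# Disproof work file — crux `EnsembleRigidity.GPStatisticalRigidity` (stmt-AnomalousDissipation-15508)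

cdisprove seat `refuter-cdisprove-stmt-AnomalousDissipation-15508-0`, cycle 1 (2026-08-16). VERDICT OF THE CYCLE:
no kill; the crux resists every cheap attack for a structural reason (§8). Four Negative files LANDED and are
imported here (everything kernel-checked lives there; this file adds the strengthening under attack, the record of
the numerical searches, and the analysis the provers should read):

* `Theorems/GPStatisticalRigidity/Negative/LoadBearing.lean` (p129641, commit 66c2bc8d601a):
  `RigidAt`, `rigid_of_crux`; `gpStatisticalRigidity_false_without_prob` (zero measure);
  `gpStatisticalRigidity_false_without_defect` (Dirac at rest); the `R = 0` kill switch
  `not_gpStatisticalRigidity_of_exactEulerStatistics` / `…_of_dodgerState` (ONE exact finite-enstrophy forced-Euler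
  statistics, e.g. the Dirac mass at ONE exact dodger, AT ANY ENERGY, refutes the crux — it quantifies over all
  levels); `rigidAt_anti`, `rigidAt_of_neg`.
* `Theorems/GPStatisticalRigidity/Negative/DiracShadow.lean` (p129915, commit 4ca42f347416):
  `lambRigidWithWork_of_rigidAt` (the Dirac instance of the crux IS single-field Lamb rigidity with work sign),
  `lambRigid_of_lambRigidWithWork` (the work-sign clause is VOID on Dirac witnesses by `U ↦ −U`: residual and
  `‖∇U‖` even, work odd), `lambRigid_of_crux` (the crux contains `VirtualDissipation.LambRigidGP`'s body at EVERY
  level), `not_gpStatisticalRigidity_of_lambSoft` (a bounded-energy near-dodger SEQUENCE `Rₙ‖∇Uₙ‖ → 0`, any work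
  sign, kills the crux — sharper than the route's KILL CRITERIA sentence).
* `Theorems/GPStatisticalRigidity/Negative/IntegrableRedundant.lean` (p130041, commit 931af39421ca): the clause
  `Integrable ‖v‖²` is REDUNDANT given `ensembleEnstrophy μ < ⊤` (Poincaré on `H`): `rigidAtNoInt_iff`, `crux_iff_noInt`.
* `Theorems/GPStatisticalRigidity/Negative/EulerSSS.lean` (p130153, commit f80b375111ed): the kill switch in FMRT
  vocabulary — ONE `IsStationaryStatisticalSolution 0 f_GP μ` (forced EULER, any mean energy) refutes the crux
  (`not_gpStatisticalRigidity_of_eulerSSS`), in particular ONE steady `H`-weak Euler solution `u ∈ V = H ∩ H¹` of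
  `P(u·∇u) = f_GP` — FINITE ENSTROPHY ONLY, no smoothness (`not_gpStatisticalRigidity_of_steadyWeakEuler`). So the
  crux contains "`f_GP` carries no FMRT stationary Euler statistics", the GP analogue of
  `ForcedSmallScales.CyclicForceCoercive` (1440), while the Kolmogorov force does carry one (1439,
  `Cruxes/SmoothEulerCoerciveForce/KolmogorovSmoothDodger.md`).

## Index of this file
* §6 `GPStatisticalRigidityUniform` — the natural strengthening with level-UNIFORM constants; `crux_of_uniform`.
* §7 record of the numerical searches (kit jobs, this seat): no exact low-shell dodger; range test inconclusive.
* §8 why the crux resists (briefing for provers and for the next disprover cycle).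

## §7 Numerical record (kit jobs of this seat, all attached to the item as evidence; `summary*.json` in their outputs)
Part A — EXACT DODGER SEARCH `P[(curl U)×U] = f_GP` over multi-shell ansätze (helical = Beltrami components on shells
`K = |k|²`, or general solenoidal shells), nonlinear least squares from random starts, free and Tikhonov-regularised
(j020649, 70 runs; j020829 = remaining 4–6-shell and general supports, results land on the item): NO EXACT CANDIDATE.
Residual floors (`L²`, of `‖f_GP‖ = 1.225`): two helical shells `(1,2) 0.878`, `(2,3) 0.927`, `(4,5) 0.974`,
`(5,6) 0.893`, `(3,6) 0.908`, `(8,9) 1.072`, `(9,10) 1.079`, `(5,10) 1.023`; pairs `(1,5), (2,6), (4,9)` cannot emit shell 1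
at all (`1.225`); three helical shells `(1,2,3) 0.753` (best overall), `(1,2,5) 0.775`, `(2,3,5) 0.794`, `(2,3,6) 0.864`.
Unregularised minima run to `E → ∞` (the §6 mechanism); regularised ones sit at `E ≈ 1–10` with the SAME floor — the floors
are structural, in accordance with the hand proof of §8(c) and with Kishimoto–Yoneda-type finite-mode rigidity
(card `finite-mode-hull-rigidity`, arXiv:2110.08039).
Part B — RANGE TEST `min_W ‖L_V W − f_GP‖_{H⁻¹}` (`L_V W = P(V·∇W + W·∇V)`, `W` all solenoidal modes with `|k|² ≤ M`),
the linear problem behind the uniform strengthening §6 (j020579): `V = ABC⁺` with phases chosen so that `(f_GP, V) = 0`: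
`0.066 (M=2) → 0.036 (6) → 0.022 (12) → 0.0196 (17)`, i.e. 10 % of `‖f‖_{H⁻¹} = 0.195` at `M = 17` with `‖W‖ ≈ 0.47`,
`‖∇W‖ ≈ 4.7`, `‖P B(W,W)‖_{H⁻¹} ≈ 0.05` bounded — slow decay, inconclusive (smooth solvability doubtful, `H⁻¹`-closure
plausible); `V = AB flow`: `0.068 → 0.030`; standard `ABC⁺` (`(f,V) = 3/2`, control): stagnant `0.139 → 0.138`
(obstructed, §8(b)); helical / planar shears: stagnant `0.119 → 0.114`, `0.163 → 0.160` (obstructed, §8(d));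
Taylor–Green 2D / 2.5D cellular: `0.160 → 0.088`. Part C (j020655, `V` free in `E^±_1`, `E^±_2`, alternating least
squares): `0.057 → 0.036 (M = 14)` resp. `0.041 → 0.030` — no finite-mode exact pair `(V, W)` either.
Part D — THE ABC-STRUCTURED CLASS `S = (F₀(x₁,x₂), F₁(x₂,x₀), F₂(x₀,x₁))` (the one template that dodges the
single-mode Kolmogorov force EXACTLY, `Cruxes/SmoothEulerCoerciveForce/KolmogorovSmoothDodger.md` §3.3), full nonlinear
residual minimised by L-BFGS with adjoint gradient (j020691 cyclic-symmetric `F₀ = F₁ = F₂`, degrees `K = 4, 6, 9`;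
j020696 three independent profiles, `K = 4`, energy caps `12 / 50 / 200`): every start converges to the SAME floor,
`0.899` (cyclic) resp. `0.854` (three profiles), INDEPENDENT of the degree and of the energy cap (the uncapped minimiser
settles at `E ≈ 55`) — 70 % of `‖f_GP‖`, against `≈ 10⁻²` at the same degrees for the Kolmogorov dodger: the class-S
template does not come close to dodging `f_GP` at these resolutions (information for the ideators as much as for the
provers).
-/

noncomputable section

open MeasureTheory UnitAddTorus
open scoped InnerProductSpace ENNReal

set_option linter.dupNamespace false

namespace Summit.AnomalousDissipation.AnomalousDissipation.Cruxes.GPStatisticalRigidity.Disproof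

open Literature.Analysis.FunctionSpaces Literature.Analysis.FunctionSpaces.Torus Literature.Analysis.FluidPDE
open Summit.AnomalousDissipation.AnomalousDissipation.Theses.EnsembleRigidity
open Summit.AnomalousDissipation.AnomalousDissipation.Theorems.GPStatisticalRigidity.Negative

/-! ## §6 Natural strengthening: level-uniform constants -/

/-- E-UNIFORM RIGIDITY (`∃ c δ₀ ∀ E`), the natural strengthening of the crux. HEURISTICALLY FALSE and the
provers should not aim at it: along `U_A = A·V + W/A` with `V` a smooth steady Euler flow and
`L_V W := P(V·∇W + W·∇V) = f_GP − r`, the Dirac mass `δ_{U_A}` has forced-Euler defect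
`R*(δ_{U_A}) = ‖r − P B(W,W)/A²‖_{H⁻¹}` (the `A²B(V,V)` term is a gradient) while `√G ≍ A‖∇V‖₂`, so
`R*√G ≲ A‖r‖_{H⁻¹} + ‖P B(W,W)‖_{H⁻¹}/A`; choosing `A = (‖PB(W,W)‖/‖r‖)^{1/2}` gives
`R*√G ≲ 2 (‖r‖_{H⁻¹}‖P B(W,W)‖_{H⁻¹})^{1/2}`: uniform rigidity fails as soon as
`inf_W ‖L_V W − f_GP‖_{H⁻¹} · ‖P B(W,W)‖_{H⁻¹} = 0` for ONE steady `V` (energy `≍ A² → ∞`, so the LEVEL-WISE crux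
is untouched). Obstructions found: `V ∈ ker L_V*` forces `(f_GP, V) = 0` (kills standard `ABC⁺`:
`(f_GP, ABC⁺) = 3/2`); every coordinate shear `V = (0, a(x₀), b(x₀))` etc. is killed by the averaged identity
`⟨W_{x₀}⟩ a' = sin 2πx₀` with `⟨W_{x₀}⟩ ≡ 0` (f_GP is "frustrated": for each axis one component is a pure
function of that coordinate). Range test for phase-shifted `ABC⁺`, `AB`, cellular flows: module docstring §7
(inconclusive, slow decay). -/
def GPStatisticalRigidityUniform : Prop :=
  ∃ c δ₀ : ℝ, 0 < c ∧ 0 < δ₀ ∧ ∀ E : ℝ, RigidAt gpForce E c δ₀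

/-- The uniform version implies the crux (so every refutation of the crux refutes it; the converse direction
is where the family `U_A` bites). -/
theorem crux_of_uniform (h : GPStatisticalRigidityUniform) : GPStatisticalRigidity := by
  obtain ⟨c, δ₀, hc, hδ₀, hall⟩ := h
  intro f hf E
  subst hf
  exact ⟨c, δ₀, hc, hδ₀, hall E⟩

/-- Level-uniform single-field Lamb rigidity (the Dirac shadow of `GPStatisticalRigidityUniform`); it follows
from the uniform strengthening by the landed Dirac-shadow lemmas, so the `U_A` family refutes the uniform
strengthening as soon as it refutes this. -/
def LambRigidUniform : Prop :=
  ∃ c δ₀ : ℝ, 0 < c ∧ 0 < δ₀ ∧ ∀ E : ℝ, LambRigidAt gpForce E c δ₀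

theorem lambRigidUniform_of_uniform (h : GPStatisticalRigidityUniform) : LambRigidUniform := by
  obtain ⟨c, δ₀, hc, hδ₀, hall⟩ := h
  exact ⟨c, δ₀, hc, hδ₀, fun E =>
    lambRigid_of_lambRigidWithWork (lambRigidWithWork_of_rigidAt isSmooth_gpForce (hall E))⟩

/-! ## §8 Why the crux resists (briefing)

(a) WHAT A KILL NEEDS. By `not_gpStatisticalRigidity_of_lambSoft` / `…_of_exactEulerStatistics`: at ONE bounded
energy level, probability measures on `H` (or smooth fields) with forced-Euler defect `R* → 0` AND `R*√G → 0`.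
With `G` bounded this is (modulo uniform integrability) an EXACT finite-enstrophy stationary forced-Euler
statistics of `f_GP` by weak compactness — an open existence problem (orbit measures of smooth steady /
time-periodic / quasi-periodic forced-Euler motions would do; none is known for `f_GP`; FGHV arXiv:1404.1098 p.6
lists the statistical K41 items (i)–(iii) as "an outstanding open problem", and their item (iii) limit
statistics carry anomalous dissipation, i.e. INFINITE enstrophy, consistent with the crux). With `G → ∞` it is
an Onsager-supercritical-but-sub-K41 roughening sequence (`R√G ≍ ℓ^{3σ−1}` for mollified `C^σ` dodgers,
`σ > 1/3` needed) — not constructible by any known method at fixed smooth force.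

(b) BIG BELTRAMI + CORRECTOR. `U = A·V + W`: pairing `B(U,U) = f` with `V ∈ ker L_V*` gives
`(f, V) = (B(W,W), V) = O(‖W‖²)`, so either `(f,V) = 0` or `‖W‖ = O(1)`; for `ABC⁺`, `(f_GP, ABC⁺) = 3/2`
(since `f_GP = (ABC⁺ + ABC⁻)/2`, `‖ABC^±‖² = 3`): the route's "A·ABC⁺ + O(1/A)" series does not exist.

(c) NO EXACT TWO-SHELL BELTRAMI DODGER (hand proof, confirmed by Part A). For `U = V + W`, `V ∈ E^{s₁}_{K₁}`,
`W ∈ E^{s₂}_{K₂}` (helical eigenspaces on shells `K₁ < K₂`), `P(U·∇U) = (λ₁ − λ₂) P(V × W)`. The SAME pair of lines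
`{±k_V}, {±k_W}` that emits a shell-1 mode (`k_V·k_W` minimal) emits the top shell `2(K₁+K₂) − 1`
(`k_V·k_W` maximal), where the output mode is produced by that pair alone and `h^{s₁}(k_V) × h^{s₂}(k_W)` is never
longitudinal (e.g. shells (1,2): third component `1/√2` at output `(2,1,0)`; (2,3): components `x ≠ y` at
`(2,2,1)`; (4,5): `z`-component `1/√5` at `(4,1,0)`); so the amplitude product vanishes, the supports decouple,
and no shell-1 output survives. ≥ 3 shells need inter-pair cancellations: Part A found none on
`{1,2,3}, {1,2,5}, {2,3,5}, {2,3,6}, {1,2,3,5}, {1,2,4,5}, {1,…,6}, {4,5,8,9}` nor on general solenoidal supports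
`{1,2}, {1,2,3}, {1,2,3,4}, {1,…,5}` (see j020620; the hub's Galerkin census, K² ≤ 14, agrees).

(d) SHEARS AND PLANAR FLOWS. Every coordinate shear is an exact steady Euler flow but cannot even absorb `f_GP`
to first order (§6 docstring); planar (2.5D) exact dodgers exist for the single-mode Kolmogorov force
(crux-dir note `Cruxes/SmoothEulerCoerciveForce/KolmogorovSmoothDodger.md`: counter-flowing bands + passive
component with monodromy paid inside a band) but `f_GP` depends on all three coordinates, and in the
ABC-structured class `(F₀(x₁,x₂), F₁(x₂,x₀), F₂(x₀,x₁))` the three averaged planar problems are coupled by the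
curl-free condition on the fluctuating residual — open.

(e) DIFFUSE STATISTICS BUY NOTHING CHEAP. Gaussian / shifted Gaussian `N(U, Q)`: the `μ`-divergence of
`F(v) = f − B(v,v)` is a cubic polynomial in the fluctuation whose homogeneous parts must vanish separately;
degree 1 forces `f = B(U,U)` (an exact dodger again); for Gibbs `Q = I/β` the defect along `Φ = ψ((v,f))` is
`‖f‖² E[ψ']`, giving `R* ≥ ‖f‖²_{L²}/‖∇f‖₂ = ‖f_GP‖_{H⁻¹} = 0.195` exactly as for `δ_{A·V}`. For ANY measure,
testing `Φ = ψ((v, f_GP))` shows that small defect needs `E_μ[b(v,v,f_GP) | (v,f_GP) = ξ] = ‖f_GP‖² = 3/2` at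
`μ`-a.e. level `ξ`: the Reynolds stress must push on the force at every level of the force coordinate.
Measures carried by UNFORCED steady states: the forcing current alone must be divergence-free, i.e. the
push-forward under `v ↦ ((v,gᵢ))ᵢ` is invariant under translation by `((f,gᵢ))ᵢ` — impossible for a probability
measure unless `f ⊥` all test fields. Time averages of GALERKIN forced Euler: boundary term `O(1/T)` is fine,
but the truncation current `⟨(1−P_N)B(u,u), Φ'(u)⟩` is `O(1)` on thermalised spectra and the energy
random-walks (no finite-energy invariant law generically).

(f) HYPOTHESIS LEDGER. prob — load-bearing (landed). defect clause — load-bearing (landed). finite enstrophy —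
load-bearing in spirit (wild `L²`/Hölder steady weak solutions of forced Euler by stationary convex integration
would be infinite-enstrophy Dirac witnesses; not constructible here; the Buckmaster–Vicol / Choffrut–Székelyhidi
barrier is what the clause evades). energy level — dropping it is the uniform strengthening §6 (heuristically
false, energy runaway). shell work ≥ 0 — VOID for Dirac / single-shell witnesses (`v ↦ −v`, landed for smooth
Diracs), a genuine restriction only for measures spread over several shells with sign-changing work.
`Integrable ‖v‖²` — REDUNDANT given `ensembleEnstrophy μ < ⊤` (Poincaré `‖v‖² ≤ ‖∇v‖²/(4π²)` on mean-zero
fields; not formalised here). Negative levels `E < 0` vacuous; very low levels vacuous too (no measure of mean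
energy `< ‖f‖⁴_{L²}/… ` has small defect: test `Φ' = f_GP`, Doering–Foias).
-/

end Summit.AnomalousDissipation.AnomalousDissipation.Cruxes.GPStatisticalRigidity.Disproof
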